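/-
Origin: expansion seat `planner-pub-hodgecm-pv13-0`, handover v2 2026-08-18T04:15:16Z / repoint 04:17:06Z (`HOME/pub-hodgecm-pv13/lean/Pv13/ConstituentSplit.lean`, md5 6290714f, 275 lines);
landed by the gen-5 packager in gate run 21 as `HodgeCM/PerL34/ConstituentSplit.lean` (import ^import Pv[0-9]+\.→import HodgeCM.PerL34. ×1).
-/
/-
Origin: pub-hodgecm-pv13 (DAG-NODE PROVER #13), node N31h (ii) (PerL v5 ll. 632–635) — the HONEST SPLIT of the
residual field `SideOutputs.allowed_of_pair` / `EulerProduct.ConstituentHalf` into TYPED sub-stubs.  Imports the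
LANDED `HodgeCM.PerL34.CharsAssembly` (run 19) and this seat's `Pv13.SchurIsotypic` (→ `HodgeCM.PerL34.SchurIsotypic`).
Proposed place: `HodgeCM/PerL34/ConstituentSplit.lean`, namespace `HodgeCM.PerL34.EulerProduct`.
Nothing cited, nothing asserted: every print / definitional input is a HYPOTHESIS FIELD, labelled (r1)–(r4) as in
HOME/GAPS.md `## pub-hodgecm-pv13` addenda 3–5; the Hilbert-space content in between is KERNEL-PROVED (Schur files).
-/
import Summits.HodgeConjecture.HodgeCM.PerL34.CharsAssembly
import Summits.HodgeConjecture.HodgeCM.PerL34.EulerProductSmoke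
import Summits.HodgeConjecture.HodgeCM.PerL34.SchurIsotypic
import Summits.HodgeConjecture.HodgeCM.PerL34.LiftExtension

set_option autoImplicit false

/-!
# N31h (ii) — the constituent half, split into typed sub-stubs

PerL v5 ll. 632–635: "Finally, `π_i` is generated by the `θ(φ,χ'_i)` with `φ_b` in the isotypic parts singled out
in (a), which realise `J⁺` at `ι₁` and `𝟏` at `b ≠ ι₁` as `(𝔤_b,K_b)`-modules [Y1neg, Lemmas 3.1, 3.2]; so every
irreducible constituent of the closure of `π_i` has archimedean component `J⁺ ⊗ 𝟏^{⊗}`, i.e. lies in `𝒜^{1,0}`."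

Until now the package carried this as ONE opaque residual (`ConstituentHalf D L : ∀ χ, θ ≠ 0 → allowed χ`, resp.
the two-line field `SideOutputs.allowed_of_pair`).  This file splits it:

* `ConstituentDictionary D L χ` — DATA and typed sub-stubs for one character and one line:
  (r4/D2) a group `G∞` acting unitarily on `L²` (`τ`); (r1) an IRREDUCIBLE unitary `G∞`-representation `V`
  ("`V_{χ̄'} = ⊗_b V_{χ̄'_b}`", BW VIII 2.10/2.14 + node N28); (r2′) the lifts `φ_f ↦ (v ↦ θ(v ⊗ φ_f, χ'))` as
  DENSELY DEFINED equivariant lifts `Schur.DenseLift` (file `LiftExtension`; referee adv2g3-O1): on the Schwartz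
  vectors (D2, definition + automorphy of the theta kernel) with a norm bound that is DERIVED from N31e + N31f
  (‖θ(v ⊗ φ_f, χ')‖² = c·vol·I_f(φ_f)·vol_∞·‖v‖² — Rallis' formula for general φ, `RallisUnfold.rallis_inner_product_formula`,
  and the compact factor `CompactFactor`; a labelled field here because this shell does not see `[G_U]`), the bounded
  `G∞`-intertwiners `V → L²` being the KERNEL extensions `DenseLift.lift` / `lift_intertwines`; (l. 633, first clause — the sentence under adjudication, TYPED not assumed true in
  general: it is a field to be discharged) `π_i ⊆` the closed span of their images; (r2) for every irreducible
  constituent `K` of the closure of `π_i` an irreducible unitary `σ_K` of `G∞` whose intertwiner images generate `K`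
  topologically ("`K|_{G∞}` is `σ_{K,∞}`-isotypic": admissibility + archimedean factorisation, Harish-Chandra /
  Flath / Borel–Jacquet; Bump, Automorphic Forms and Representations, Thm 3.3.3/3.3.4, p. 296, for `GL_n`).
* `ConstituentDictionary.archType_matches` — KERNEL THEOREM (Schur layer, `Schur.local_component_of_constituent`):
  from the data alone, EVERY constituent's archimedean type is `≅ V` ("has archimedean component `J⁺ ⊗ 𝟏^⊗`").
* `AllowedBridge D fst snd` — the remaining definitional / print clause for a SIDE (two lines): Def 3.2
  (ll. 269–279: allowed ⇔ `π_i ≠ 0` and every constituent in `𝒜^{1,0}`) + the definition of `𝒜^{1,0}` by archimedean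
  component (tex §2; BW VI Thm 4.11, VII Prop 4.11) + (r1)'s identification `V ≅ J⁺ ⊗ 𝟏^⊗`: both lifts non-zero and
  both lines' constituents of archimedean type `V` ⇒ `χ` arises from an allowed pair.
* `SideOutputs.ofBridge` — the landed two-line package REBUILT from the split, its residual field now DERIVED:
  `allowed_of_pair = bridge ∘ (archType_matches, archType_matches)`; hence `allowed_all`, `charsDischarge`, and the
  whole N31 chain (`CharsAssembly`) run on the finer inputs.
* `Smoke` — the split is inhabited over the prior one-point torus (`HG = ℂ`, `G∞ = unitary ℂ` acting trivially,
  `V = ℂ`): definitions compute and `archType_matches` fires.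
-/

noncomputable section

open scoped InnerProductSpace
open ContinuousLinearMap

namespace HodgeCM
namespace PerL34
namespace EulerProduct

open HodgeCM.Prior.Perl34File
open HodgeCM.PerL34.Schur

/-- An irreducible unitary representation of `G`, bundled with its Hilbert space. -/
structure IrrepPkg (G : Type) [Group G] where
  /-- the representation space -/
  W : Type
  [instNACG : NormedAddCommGroup W]
  [instIPS : InnerProductSpace ℂ W]
  [instCS : CompleteSpace W]
  /-- the unitary action -/
  σ : G →* unitary (W →L[ℂ] W)
  /-- topological irreducibility (only `⊥`, `⊤` are closed invariant subspaces) -/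
  irred : Schur.Irreducible σ

attribute [instance] IrrepPkg.instNACG IrrepPkg.instIPS IrrepPkg.instCS

section Dictionary

variable {H HG CG G SK SigIdx SigIdxG : Type*}
variable [NormedAddCommGroup H] [InnerProductSpace ℂ H] [CompleteSpace H]
variable [NormedAddCommGroup HG] [InnerProductSpace ℂ HG] [CompleteSpace HG]
variable [NormedAddCommGroup CG] [NormedSpace ℂ CG]
variable [Group G] [TopologicalSpace G] [TopologicalSpace SK]
variable {C : Perl34.IsolationCore H HG CG G SK SigIdx SigIdxG}
variable {Pl : Type}

/-- **Typed sub-stubs (r1), (r2), (r2′), (r4) of N31h (ii) for ONE character `χ` and ONE line** (see the module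
docstring for the print sources of each field).  `HG` is the ambient `L²([G_U])` of the isolation core, in which
the lifts `(L χ).Theta` and the closure of their span `π_i` live. -/
structure ConstituentDictionary (D : Perl34.TorusData C) (L : D.X → LocalFactorDatum Pl HG) (χ : D.X) where
  /-- (r4 / D2) the archimedean group `G∞ = ∏_b G_b` -/
  Gi : Type
  [instGroup : Group Gi]
  /-- (r4 / D2) its unitary action on `L²([G_U])` (right translation) -/
  τ : Gi →* unitary (HG →L[ℂ] HG)
  /-- (r1) PRINT: `V_{χ̄'} = ⊗_b V_{χ̄'_b}`, the isotypic parts singled out in L4.2(a), an IRREDUCIBLE unitary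
  representation of `G∞` (BW VIII 2.10, 2.14; node N28 for the weights) -/
  arch : IrrepPkg Gi
  /-- (r2′ / D2) index set of finite test vectors `φ_f` -/
  LiftIdx : Type
  /-- (r2′) the lifts `φ_f ↦ (v ↦ θ(v ⊗ φ_f, χ'))` as DENSELY DEFINED equivariant lifts (adv2g3-O1): fields
  `S, dense, inv, θ₀, equivariant` = (D2/D5) Schwartz vectors, definition and automorphy of the theta kernel;
  field `norm_le` = (r2′-an) DERIVED from N31e (`RallisUnfold.rallis_inner_product_formula`, general φ) + N31f
  (`CompactFactor`): ‖θ(v ⊗ φ_f, χ')‖² = C(φ_f)·‖v‖².  The bounded intertwiners are then KERNEL (`lift` below). -/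
  dl : LiftIdx → Schur.DenseLift arch.σ τ
  /-- l. 633 first clause, TYPED: `π_i` (the span of all lifts `θ(φ', χ')`) lies in the closed span of the lifts
  with archimedean component in `V_{χ̄'}` -/
  span_le : Submodule.span ℂ (L χ).Theta ≤ (⨆ j, LinearMap.range (dl j).lift.toLinearMap).topologicalClosure
  /-- (D5) "irreducible constituent of the `L²`-closure of `π_i`", as a predicate on closed subspaces of `L²` -/
  Constituent : Submodule ℂ HG → Prop
  constituent_closed : ∀ K, Constituent K → IsClosed (K : Set HG)
  constituent_inv : ∀ K, Constituent K → Schur.Invariant (Schur.ops τ) K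
  constituent_ne_bot : ∀ K, Constituent K → K ≠ ⊥
  constituent_le : ∀ K, Constituent K → K ≤ (Submodule.span ℂ (L χ).Theta).topologicalClosure
  /-- (r2) PRINT: the archimedean component `σ_{K,∞}` of a constituent — an irreducible unitary representation
  of `G∞` … -/
  archType : ∀ K, Constituent K → IrrepPkg Gi
  /-- (r2) … index set and family of `G∞`-intertwiners `σ_{K,∞} → L²` … -/
  GenIdx : Type
  gen : ∀ K (h : Constituent K), GenIdx → ((archType K h).W →L[ℂ] HG)
  gen_intertwines : ∀ K (h : Constituent K) (i : GenIdx), Schur.Intertwines (archType K h).σ τ (gen K h i)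
  /-- (r2) … whose images generate `K` topologically ("`K|_{G∞}` is `σ_{K,∞}`-isotypic") -/
  gen_dense : ∀ K (h : Constituent K), K ≤ (⨆ i, LinearMap.range (gen K h i).toLinearMap).topologicalClosure

attribute [instance] ConstituentDictionary.instGroup

namespace ConstituentDictionary

variable {D : Perl34.TorusData C} {L : D.X → LocalFactorDatum Pl HG} {χ : D.X}

/-- **KERNEL (adv2g3-O1)**: the bounded lifts `V_{χ̄'} → L²`, extensions by density of the Schwartz lifts … -/
def lift (δ : ConstituentDictionary D L χ) (j : δ.LiftIdx) : δ.arch.W →L[ℂ] HG := (δ.dl j).lift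

/-- … are `G∞`-intertwiners (equivariance passes to the closure). -/
theorem lift_intertwines (δ : ConstituentDictionary D L χ) (j : δ.LiftIdx) :
    Schur.Intertwines δ.arch.σ δ.τ (δ.lift j) :=
  (δ.dl j).lift_intertwines

/-- "Every irreducible constituent of the closure of `π_i` has archimedean component `≅ V_{χ̄'}`." -/
def ArchTypeMatches (δ : ConstituentDictionary D L χ) : Prop :=
  ∀ K (h : δ.Constituent K), ∃ U : δ.arch.W ≃ₗᵢ[ℂ] (δ.archType K h).W,
    ∀ (g : δ.Gi) (x : δ.arch.W), U ((δ.arch.σ g : δ.arch.W →L[ℂ] δ.arch.W) x) =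
      ((δ.archType K h).σ g : (δ.archType K h).W →L[ℂ] (δ.archType K h).W) (U x)

/-- **KERNEL THEOREM (the Hilbert-space content of ll. 633–635).**  From the dictionary data alone, every
irreducible constituent of the closure of `π_i` has archimedean component `≅ V_{χ̄'}` — by
`Schur.local_component_of_constituent` (orthogonal projections commute with the action; Schur's lemma via the
continuous functional calculus; density). -/
theorem archType_matches (δ : ConstituentDictionary D L χ) : δ.ArchTypeMatches := by
  intro K hK
  have hKle : K ≤ (⨆ j, LinearMap.range (δ.lift j).toLinearMap).topologicalClosure :=
    (δ.constituent_le K hK).trans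
      (Submodule.topologicalClosure_minimal _ δ.span_le (Submodule.isClosed_topologicalClosure _))
  exact Schur.local_component_of_constituent δ.arch.irred (δ.archType K hK).irred δ.lift δ.lift_intertwines K
    (δ.constituent_closed K hK) (δ.constituent_inv K hK) (δ.constituent_ne_bot K hK) hKle (δ.gen K hK)
    (δ.gen_intertwines K hK) (δ.gen_dense K hK)

/-- The closure of `π_i` is itself non-zero (N31h (i)), so the constituent clause is not about the empty set of
subspaces for want of vectors: `θ_φ(χ') ≠ 0` lies in it. -/
theorem theta_mem_closure (δ : ConstituentDictionary D L χ) :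
    (L χ).theta ∈ (⨆ j, LinearMap.range (δ.lift j).toLinearMap).topologicalClosure ∧ (L χ).theta ≠ 0 :=
  ⟨δ.span_le (Submodule.subset_span (L χ).theta_mem), (L χ).theta_ne_zero⟩

end ConstituentDictionary

/-- **Typed sub-stub (r3) + Def 3.2 for a SIDE (two lines).**  Def 3.2 (ll. 269–279): `(W_i, μ_i, χ'_i)` is allowed
iff `π_i ≠ 0` and every irreducible constituent of its closure lies in `𝒜^{1,0}`; `𝒜^{1,0}` is membership by
archimedean component `J⁺ ⊗ 𝟏^⊗` (tex §2; BW VI Thm 4.11 / VII Prop 4.11); and `J⁺ ⊗ 𝟏^⊗ ≅ V_{χ̄'}` is (r1).  So: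
both lifts non-zero and both lines' constituents of archimedean type `V_{χ̄'_1}`, `V_{χ̄'_2}` ⇒ `χ = χ'_1 ⊠ χ'_2`
arises from an allowed pair (`TorusData.allowed`, the prior interface's reading of Def 3.2). -/
structure AllowedBridge (D : Perl34.TorusData C) (fst snd : D.X → LocalFactorDatum Pl HG) where
  /-- the dictionaries of the two lines, per character -/
  dict₁ : ∀ χ, ConstituentDictionary D fst χ
  dict₂ : ∀ χ, ConstituentDictionary D snd χ
  /-- Def 3.2 + definition of `𝒜^{1,0}` + (r1), as ONE implication into the opaque predicate -/
  allowed_of : ∀ χ, (fst χ).theta ≠ 0 → (snd χ).theta ≠ 0 →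
    (dict₁ χ).ArchTypeMatches → (dict₂ χ).ArchTypeMatches → D.allowed χ

namespace AllowedBridge

variable {D : Perl34.TorusData C} {fst snd : D.X → LocalFactorDatum Pl HG}

/-- **The two-line package of the landed `CharsAssembly`, REBUILT from the split**: its residual field
`allowed_of_pair` is now the bridge applied to two KERNEL theorems. -/
def toSideOutputs (B : AllowedBridge D fst snd) : SideOutputs D Pl where
  fst := fst
  snd := snd
  allowed_of_pair χ h₁ h₂ := B.allowed_of χ h₁ h₂ (B.dict₁ χ).archType_matches (B.dict₂ χ).archType_matches

/-- Lemma 4.2(b) for the side in the consumed form, from the split inputs. -/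
theorem allowed_all (B : AllowedBridge D fst snd) : ∀ χ : D.X, D.allowed χ :=
  B.toSideOutputs.allowed_all

/-- The one-line residual of `EulerProduct` for the first line, from the split inputs. -/
theorem constituentHalf_fst (B : AllowedBridge D fst snd) : ConstituentHalf D fst :=
  B.toSideOutputs.constituentHalf_fst

/-- The prior / carver `CharsDischarge` package of the side, from the split inputs. -/
def charsDischarge (B : AllowedBridge D fst snd) : Perl34.C4.CharsDischarge D Pl :=
  B.toSideOutputs.charsDischarge

end AllowedBridge

end Dictionary

/-! ### Non-vacuity of the split over the prior one-point torus -/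

namespace Smoke

open ConstituentDictionary

/-- The trivial one-dimensional representation of `U(1)` on `ℂ` is irreducible (its only subspaces are `⊥`, `⊤`). -/
def trivIrrep : IrrepPkg (unitary ℂ) where
  W := ℂ
  σ := 1
  irred := fun K _ _ => Ideal.eq_bot_or_top K

/-- A dictionary for the smoke datum (`HG = ℂ`, `Theta = {1}`): `G∞ = U(1)` acting trivially, `V = ℂ`, one lift
(the identity, densely defined on `⊤`), one constituent (`⊤`) of archimedean type the trivial irrep, generated by the identity. -/
def dict (χ : Perl34.SmokeS4.torus.X) : ConstituentDictionary Perl34.SmokeS4.torus (fun _ => datum) χ where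
  Gi := unitary ℂ
  τ := 1
  arch := trivIrrep
  LiftIdx := Unit
  dl _ := Schur.DenseLift.top trivIrrep.σ
  span_le := by
    refine Submodule.span_le.mpr fun y _ => Submodule.le_topologicalClosure _ ?_
    exact Submodule.mem_iSup_of_mem () (LinearMap.mem_range.mpr ⟨y, Schur.DenseLift.top_lift_apply _ y⟩)
  Constituent K := K = ⊤
  constituent_closed := by
    rintro K rfl
    rw [Submodule.top_coe]
    exact isClosed_univ
  constituent_inv := by
    rintro K rfl s _ x _
    exact Submodule.mem_top
  constituent_ne_bot := by
    rintro K rfl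
    exact top_ne_bot
  constituent_le := by
    rintro K rfl x -
    have h1 : (1 : ℂ) ∈ Submodule.span ℂ datum.Theta := Submodule.subset_span rfl
    have hx : x = x • (1 : ℂ) := by rw [smul_eq_mul, mul_one]
    refine Submodule.le_topologicalClosure _ ?_
    rw [hx]
    exact Submodule.smul_mem _ x h1
  archType _ _ := trivIrrep
  GenIdx := Unit
  gen _ _ _ := ContinuousLinearMap.id ℂ ℂ
  gen_intertwines _ _ _ g := rfl
  gen_dense := by
    rintro K rfl y -
    exact Submodule.le_topologicalClosure _ (Submodule.mem_iSup_of_mem () (LinearMap.mem_range.mpr ⟨y, rfl⟩))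

/-- The kernel theorem fires on the smoke dictionary: the constituent `⊤ = ℂ` is equivariantly isometric to `V = ℂ`. -/
theorem archType_matches_smoke (χ : Perl34.SmokeS4.torus.X) : (dict χ).ArchTypeMatches :=
  (dict χ).archType_matches

/-- The bridge over the one-point torus (`allowed ≡ True`). -/
def bridge : AllowedBridge Perl34.SmokeS4.torus (fun _ => datum) (fun _ => datum) where
  dict₁ := dict
  dict₂ := dict
  allowed_of _ _ _ _ _ := trivial

/-- The rebuilt side package is inhabited and yields "every character is allowed". -/
theorem allowed_all_bridge : ∀ χ : Perl34.SmokeS4.torus.X, Perl34.SmokeS4.torus.allowed χ :=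
  bridge.allowed_all

end Smoke

end EulerProduct
end PerL34
end HodgeCM

end
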